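import Summits.ABC.ABC.Theorems.FeketeScalesTargetEffectiveFekete
import Summits.ABC.ABC.Theorems.FeketeScalesTargetLogicalPosition

/-!
# Route FeketeScales — crux `Target` (stmt-ABC-2159): the EFFECTIVE form of the thesis

Third file (`--supports stmt-ABC-2159`, closes nothing).  `Target = ScaleSubmultiplicativity ∧
SparseGoodScales` and `Target ↔ ScaleSubmultiplicativity ∧ ABC`
(`Target.target_iff_scaleSubmultiplicativity_and_abc`).  Write SPS for the pointwise sub-power slack
`∃ τ < 1, ∃ A, c < rad · exp(A (log rad)^τ)` (⟺ abc with a quasi-polynomial constant,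
`calib_polyConstant_iff_subPowerSlack`), through which every line of the crux passes.  Two effective
versions of conjunct 2:

* EFFECTIVE GOOD SCALES (every `R ≥ exp(C δ^{-B})` is `δ`-good): this is SPS BY ITSELF, by trivial
  bookkeeping (`Target.polyConstant_of_effectiveGoodScales`: bound a triple at the scale
  `max(rad, ⌈exp(C δ^{-B})⌉)`), so `SPS ↔ ScaleSubmultiplicativity ∧ EffectiveGoodScales`
  (`calib_subPowerSlack_iff_scaleSubmultiplicativity_and_effectiveGoodScales`, registered calibration
  sub-goal) holds with a redundant first conjunct.
* EFFECTIVE SPARSE GOOD SCALES (every window `[N, N²]` with `N ≥ exp(C δ^{-B})` contains a `δ`-good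
  scale): on its own this gives only `c ≪_δ rad^{2+2δ}`; WITH scale sub-multiplicativity the Fekete
  upgrade run with explicit constants (`TargetEff.logBound_core`) gives abc with a quasi-polynomial
  constant (`Target.polyConstant_of_scaleSubmultiplicativity_of_effectiveSparseGoodScales`), whence the
  substantive equivalence
  `calib_subPowerSlack_iff_scaleSubmultiplicativity_and_effectiveSparseGoodScales :
  SPS ↔ ScaleSubmultiplicativity ∧ EffectiveSparseGoodScales`.

Read against `Target ↔ ScaleSubmultiplicativity ∧ SparseGoodScales`: the crux is the pointwise
sub-power slack (the hypothesis implied by Robert–Stewart–Tenenbaum's Conjecture A) with the location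
of the sparse good scales made INEFFECTIVE — and nothing else:
`Target.subPowerSlack_iff_target_and_effectiveSparseGoodScales : SPS ↔ Target ∧ EffectiveSparseGoodScales`
and, under the crux, `Target.effectiveSparseGoodScales_iff_subPowerSlack_of_target :
EffectiveSparseGoodScales ↔ SPS`.  Consequently the registered stub
`stub_ultraCompositeTail` of line `SketchIdeator2` follows from `Target` plus that effectivity
(`Target.ultraCompositeTail_of_target_of_effectiveSparseGoodScales`): modulo effectivity of conjunct 2
the ω-split line's two stubs are jointly equivalent to the crux.

Mathlib only; no new definitions (statements inlined in the tree's vocabulary).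
-/

-- `Summit.<Summit>.<Problem>` is the mandated summit-side namespace (CONVENTIONS §2); for the
-- single-conjunct summit `ABC` the two coincide, so the duplicate `ABC.ABC` is deliberate.
set_option linter.dupNamespace false

namespace Summit.ABC.ABC.Theorems

open Literature.NumberTheory.DiophantineGeometry
open Summit.ABC.ABC.Theses.FeketeScales

/-- **Effective good scales at ALL large scales is already abc with a quasi-polynomial constant**
(trivial bookkeeping, no sub-multiplicativity needed): bound a triple of radical `r` at the scale
`R = max r ⌈exp(C ε^{-B})⌉ ≤ r ⌈exp(C ε^{-B})⌉`, so `c ≤ R^{1+ε} ≤ T² r^{1+ε}` with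
`T = ⌈exp(C ε^{-B})⌉ ≤ 2 exp(|C| ε^{-k})`, `k = max B 0`; hence `c ≤ exp((2 + 2|C|) ε^{-k}) r^{1+ε}`.
[folklore] -/
theorem Target.polyConstant_of_effectiveGoodScales
    (h : ∃ B C : ℝ, ∀ δ : ℝ, 0 < δ → δ ≤ 1 → ∀ R : ℕ, Real.exp (C * δ ^ (-B)) ≤ (R : ℝ) →
      ∀ a b c : ℕ, IsABCTriple a b c → rad a b c ≤ R → (c : ℝ) ≤ (R : ℝ) ^ (1 + δ)) :
    ∃ κ A : ℝ, ∀ ε : ℝ, 0 < ε → ε ≤ 1 → ∀ a b c : ℕ, IsABCTriple a b c →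
      (c : ℝ) ≤ Real.exp (A * ε ^ (-κ)) * ((rad a b c : ℕ) : ℝ) ^ (1 + ε) := by
  obtain ⟨B, C, h⟩ := h
  set k : ℝ := max B 0 with hk
  refine ⟨k, 2 + 2 * |C|, ?_⟩
  intro ε hε hε1 a b c habc
  set g : ℝ := C * ε ^ (-B) with hg
  set T : ℕ := ⌈Real.exp g⌉₊ with hT
  have hTexp : Real.exp g ≤ (T : ℝ) := Nat.le_ceil _
  have hTlt : (T : ℝ) < Real.exp g + 1 := Nat.ceil_lt_add_one (Real.exp_pos _).le
  have hT1 : (1 : ℝ) ≤ T := by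
    have h1 : 1 ≤ T := Nat.one_le_ceil_iff.mpr (Real.exp_pos g)
    exact_mod_cast h1
  set r : ℕ := rad a b c with hr
  have hr2 : 2 ≤ r := habc.two_le_rad
  have hr1 : (1 : ℝ) ≤ r := by exact_mod_cast (by omega : 1 ≤ r)
  have hrpos : (0 : ℝ) < r := by linarith
  -- the scale `R = max r T ≤ r T`
  have hT0 : (0 : ℝ) ≤ T := by linarith
  set R : ℕ := max r T with hR
  have hRT : (T : ℝ) ≤ R := by exact_mod_cast le_max_right _ _
  have hRr : r ≤ R := le_max_left _ _
  have hRpos : (0 : ℝ) < R := by linarith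
  have hRle : (R : ℝ) ≤ r * T := by
    rw [hR, Nat.cast_max]
    exact max_le (le_mul_of_one_le_right hrpos.le hT1) (le_mul_of_one_le_left hT0 hr1)
  have hc : (c : ℝ) ≤ (R : ℝ) ^ (1 + ε) := h ε hε hε1 R (hTexp.trans hRT) a b c habc hRr
  -- `R^{1+ε} ≤ (r T)^{1+ε} = r^{1+ε} T^{1+ε} ≤ r^{1+ε} T²` and `T ≤ 2 exp(g⁺)`
  have h1 : (R : ℝ) ^ (1 + ε) ≤ (r : ℝ) ^ (1 + ε) * (T : ℝ) ^ (1 + ε) := by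
    rw [← Real.mul_rpow hrpos.le hT0]
    exact Real.rpow_le_rpow hRpos.le hRle (by linarith)
  have h2 : (T : ℝ) ^ (1 + ε) ≤ (T : ℝ) ^ (2 : ℝ) :=
    Real.rpow_le_rpow_of_exponent_le hT1 (by linarith)
  set g' : ℝ := max g 0 with hg'
  have hgg' : g ≤ g' := le_max_left _ _
  have hg'0 : 0 ≤ g' := le_max_right _ _
  have hexpg' : 1 ≤ Real.exp g' := Real.one_le_exp hg'0
  have hT2 : (T : ℝ) ≤ 2 * Real.exp g' := by
    have := Real.exp_le_exp.mpr hgg'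
    linarith
  have h3 : (T : ℝ) ^ (2 : ℝ) ≤ (2 * Real.exp g') ^ (2 : ℝ) :=
    Real.rpow_le_rpow hT0 hT2 (by norm_num)
  -- `(2 exp g⁺)² = exp(2 log 2 + 2 g⁺) ≤ exp((2 + 2|C|) ε^{-k})`
  have hεk1 : 1 ≤ ε ^ (-k) := TargetEff.one_le_rpow_neg hε hε1 (le_max_right _ _)
  have hgk : g ≤ |C| * ε ^ (-k) := by
    rw [hg]
    rcases le_or_gt 0 C with hC | hC
    · calc C * ε ^ (-B) ≤ C * ε ^ (-k) :=
            mul_le_mul_of_nonneg_left (TargetEff.rpow_neg_le_rpow_neg hε hε1 (le_max_left _ _)) hC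
        _ = |C| * ε ^ (-k) := by rw [abs_of_nonneg hC]
    · have h1 : C * ε ^ (-B) ≤ 0 := mul_nonpos_of_nonpos_of_nonneg hC.le (Real.rpow_nonneg hε.le _)
      have h2 : 0 ≤ |C| * ε ^ (-k) := mul_nonneg (abs_nonneg C) (zero_le_one.trans hεk1)
      linarith
  have hg'k : g' ≤ |C| * ε ^ (-k) :=
    max_le hgk (mul_nonneg (abs_nonneg C) (zero_le_one.trans hεk1))
  have h4 : (2 * Real.exp g') ^ (2 : ℝ) ≤ Real.exp ((2 + 2 * |C|) * ε ^ (-k)) := by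
    have e1 : (2 * Real.exp g') ^ (2:ℝ) = Real.exp (Real.log 2 * 2 + g' * 2) := by
      rw [Real.exp_add, Real.exp_mul, Real.exp_mul, Real.exp_log two_pos,
        Real.mul_rpow (by norm_num) (Real.exp_pos _).le]
    rw [e1, Real.exp_le_exp]
    have hl2 : Real.log 2 < 1 := by have := Real.log_two_lt_d9; linarith
    have e2 : (2 + 2 * |C|) * ε ^ (-k) = 2 * ε ^ (-k) + 2 * (|C| * ε ^ (-k)) := by ring
    rw [e2]
    linarith
  have hrpow0 : 0 ≤ (r : ℝ) ^ (1 + ε) := Real.rpow_nonneg hrpos.le _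
  calc (c : ℝ) ≤ (R : ℝ) ^ (1 + ε) := hc
    _ ≤ (r : ℝ) ^ (1 + ε) * (T : ℝ) ^ (1 + ε) := h1
    _ ≤ (r : ℝ) ^ (1 + ε) * Real.exp ((2 + 2 * |C|) * ε ^ (-k)) :=
        mul_le_mul_of_nonneg_left ((h2.trans h3).trans h4) hrpow0
    _ = Real.exp ((2 + 2 * |C|) * ε ^ (-k)) * ((rad a b c : ℕ) : ℝ) ^ (1 + ε) := by
        rw [hr, mul_comm]

/-- **`SPS ↔ ScaleSubmultiplicativity ∧ EffectiveGoodScales`** (registered calibration sub-goal of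
line `SketchIdeator2`, stated fully qualified on one line).  (→): conjunct 1 is the route's support
`submultOfRST_proof` (stmt-ABC-10340) and the effectivity is
`Target.effectiveGoodScales_of_polyConstant ∘ Target.polyConstant_of_subPowerSlack`; (←): already the
second conjunct alone gives SPS (`Target.polyConstant_of_effectiveGoodScales`, Legendre duality) — the
ALL-large-scales effective form makes conjunct 1 redundant; the sparse form below does not. [folklore] -/
theorem calib_subPowerSlack_iff_scaleSubmultiplicativity_and_effectiveGoodScales : (∃ τ : ℝ, τ < 1 ∧ ∃ A : ℝ, ∀ a b c : ℕ, Literature.NumberTheory.DiophantineGeometry.IsABCTriple a b c → (c : ℝ) < ((Literature.NumberTheory.DiophantineGeometry.rad a b c : ℕ) : ℝ) * Real.exp (A * Real.log ((Literature.NumberTheory.DiophantineGeometry.rad a b c : ℕ) : ℝ) ^ τ)) ↔ (Summit.ABC.ABC.Theses.FeketeScales.ScaleSubmultiplicativity ∧ ∃ B C : ℝ, ∀ δ : ℝ, 0 < δ → δ ≤ 1 → ∀ R : ℕ, Real.exp (C * δ ^ (-B)) ≤ (R : ℝ) → ∀ a b c : ℕ, Literature.NumberTheory.DiophantineGeometry.IsABCTriple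 a b c → Literature.NumberTheory.DiophantineGeometry.rad a b c ≤ R → (c : ℝ) ≤ (R : ℝ) ^ (1 + δ)) :=
  ⟨fun h => ⟨submultOfRST_proof h,
      Target.effectiveGoodScales_of_polyConstant (Target.polyConstant_of_subPowerSlack h)⟩,
    fun h => Target.subPowerSlack_of_polyConstant (Target.polyConstant_of_effectiveGoodScales h.2)⟩

/-- **Scale sub-multiplicativity + EFFECTIVE SPARSE good scales ⟹ abc with a quasi-polynomial
constant** — the effective Assembly.  Hypothesis 2: every window `[N, N²]` with `N ≥ exp(C δ^{-B})`
contains a `δ`-good scale (alone: only `c ≪_δ rad^{2+2δ}`).  Normalise the crux data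
(`FeketeScalesAssembly.submult_normalise`), enlarge `B, C` to `≥ 1`, run `TargetEff.logBound_core`
with `δ = ε/3`, and use `(ε/3)^{-k} = 3^k ε^{-k}`.  Both hypotheses are conjecture-grade and are taken
as hypotheses. [folklore] -/
theorem Target.polyConstant_of_scaleSubmultiplicativity_of_effectiveSparseGoodScales
    (hS : ScaleSubmultiplicativity)
    (hE : ∃ B C : ℝ, ∀ δ : ℝ, 0 < δ → δ ≤ 1 → ∀ N : ℕ, Real.exp (C * δ ^ (-B)) ≤ (N : ℝ) →
      ∃ R : ℕ, N ≤ R ∧ R ≤ N ^ 2 ∧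
        ∀ a b c : ℕ, IsABCTriple a b c → rad a b c ≤ R → (c : ℝ) ≤ (R : ℝ) ^ (1 + δ)) :
    ∃ κ A : ℝ, ∀ ε : ℝ, 0 < ε → ε ≤ 1 → ∀ a b c : ℕ, IsABCTriple a b c →
      (c : ℝ) ≤ Real.exp (A * ε ^ (-κ)) * ((rad a b c : ℕ) : ℝ) ^ (1 + ε) := by
  obtain ⟨θ, hθ1, K, hK, R₀, h⟩ := hS
  obtain ⟨B, C, hg⟩ := hE
  have hsub := FeketeScalesAssembly.submult_normalise hK h
  -- enlarge the effectivity constants to `≥ 1`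
  set B' : ℝ := max B 1 with hB'
  set C' : ℝ := max C 1 with hC'
  have hB'1 : 1 ≤ B' := le_max_right _ _
  have hC'1 : 1 ≤ C' := le_max_right _ _
  have hthr : ∀ δ : ℝ, 0 < δ → δ ≤ 1 → C * δ ^ (-B) ≤ C' * δ ^ (-B') := by
    intro δ hδ hδ1
    have hmono : δ ^ (-B) ≤ δ ^ (-B') := TargetEff.rpow_neg_le_rpow_neg hδ hδ1 (le_max_left _ _)
    have hpos : 0 < δ ^ (-B') := Real.rpow_pos_of_pos hδ _
    rcases le_or_gt C 0 with hC0 | hC0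
    · have h1 : C * δ ^ (-B) ≤ 0 := mul_nonpos_of_nonpos_of_nonneg hC0 (Real.rpow_nonneg hδ.le _)
      have h2 : 0 ≤ C' * δ ^ (-B') := mul_nonneg (zero_le_one.trans hC'1) hpos.le
      linarith
    · calc C * δ ^ (-B) ≤ C * δ ^ (-B') := mul_le_mul_of_nonneg_left hmono hC0.le
        _ ≤ C' * δ ^ (-B') := mul_le_mul_of_nonneg_right (le_max_left _ _) hpos.le
  have hgood : ∀ δ : ℝ, 0 < δ → δ ≤ 1 → ∀ N : ℕ, Real.exp (C' * δ ^ (-B')) ≤ (N : ℝ) →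
      ∃ R : ℕ, N ≤ R ∧ R ≤ N ^ 2 ∧
        ∀ a b c : ℕ, IsABCTriple a b c → rad a b c ≤ R → (c : ℝ) ≤ (R : ℝ) ^ (1 + δ) :=
    fun δ hδ hδ1 N hN => hg δ hδ hδ1 N ((Real.exp_le_exp.mpr (hthr δ hδ hδ1)).trans hN)
  obtain ⟨k, A, hk0, hcore⟩ := TargetEff.logBound_core (le_max_right θ 0) (max_lt hθ1 one_pos)
    (le_max_right _ _) hB'1 hC'1 (le_max_right R₀ 2) hsub hgood
  refine ⟨k, A * 3 ^ k, ?_⟩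
  intro ε hε hε1 a b c habc
  have hδ : 0 < ε / 3 := by positivity
  have hδ1 : ε / 3 ≤ 1 := by linarith
  have h1 := hcore (ε / 3) hδ hδ1 a b c habc
  have hcpos : (0:ℝ) < c := by
    obtain ⟨ha, hb, habc', -⟩ := habc; exact_mod_cast (show 0 < c by omega)
  have hrad0 : (0:ℝ) < ((rad a b c : ℕ) : ℝ) := by
    exact_mod_cast lt_of_lt_of_le two_pos (SubmultOfRST.two_le_rad habc)
  have hpow : (ε / 3) ^ (-k) = ε ^ (-k) * 3 ^ k := by
    rw [Real.div_rpow hε.le (by norm_num : (0:ℝ) ≤ 3), Real.rpow_neg (by norm_num : (0:ℝ) ≤ 3),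
      div_inv_eq_mul]
  have h2 : Real.log (c : ℝ) ≤ (1 + ε) * Real.log ((rad a b c : ℕ) : ℝ) + A * 3 ^ k * ε ^ (-k) := by
    have e : (1 + 3 * (ε / 3)) = 1 + ε := by ring
    rw [e, hpow] at h1
    linarith
  calc (c : ℝ) = Real.exp (Real.log c) := (Real.exp_log hcpos).symm
    _ ≤ Real.exp ((1 + ε) * Real.log ((rad a b c : ℕ) : ℝ) + A * 3 ^ k * ε ^ (-k)) :=
        Real.exp_le_exp.mpr h2
    _ = Real.exp (A * 3 ^ k * ε ^ (-k)) * ((rad a b c : ℕ) : ℝ) ^ (1 + ε) := by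
        rw [Real.exp_add, Real.rpow_def_of_pos hrad0]; ring_nf

/-- Effective good scales at all large scales are in particular effective SPARSE good scales (take
`R = N`). [folklore] -/
theorem Target.effectiveSparseGoodScales_of_effectiveGoodScales
    (h : ∃ B C : ℝ, ∀ δ : ℝ, 0 < δ → δ ≤ 1 → ∀ R : ℕ, Real.exp (C * δ ^ (-B)) ≤ (R : ℝ) →
      ∀ a b c : ℕ, IsABCTriple a b c → rad a b c ≤ R → (c : ℝ) ≤ (R : ℝ) ^ (1 + δ)) :
    ∃ B C : ℝ, ∀ δ : ℝ, 0 < δ → δ ≤ 1 → ∀ N : ℕ, Real.exp (C * δ ^ (-B)) ≤ (N : ℝ) →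
      ∃ R : ℕ, N ≤ R ∧ R ≤ N ^ 2 ∧
        ∀ a b c : ℕ, IsABCTriple a b c → rad a b c ≤ R → (c : ℝ) ≤ (R : ℝ) ^ (1 + δ) := by
  obtain ⟨B, C, h⟩ := h
  exact ⟨B, C, fun δ hδ hδ1 N hN => ⟨N, le_rfl, Nat.le_self_pow two_ne_zero N, h δ hδ hδ1 N hN⟩⟩

/-- Effective sparse good scales are in particular sparse good scales (`SparseGoodScales`): for `δ`
(WLOG `≤ 1`) and `N`, the window above `max (max N 1) ⌈exp(C δ'^{-B})⌉` contains a good scale.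
[folklore] -/
theorem Target.sparseGoodScales_of_effectiveSparseGoodScales
    (h : ∃ B C : ℝ, ∀ δ : ℝ, 0 < δ → δ ≤ 1 → ∀ N : ℕ, Real.exp (C * δ ^ (-B)) ≤ (N : ℝ) →
      ∃ R : ℕ, N ≤ R ∧ R ≤ N ^ 2 ∧
        ∀ a b c : ℕ, IsABCTriple a b c → rad a b c ≤ R → (c : ℝ) ≤ (R : ℝ) ^ (1 + δ)) :
    SparseGoodScales := by
  obtain ⟨B, C, h⟩ := h
  unfold SparseGoodScales
  intro δ hδ N
  set δ' : ℝ := min δ 1 with hδ'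
  have hδ'0 : 0 < δ' := lt_min hδ one_pos
  have hδ'1 : δ' ≤ 1 := min_le_right _ _
  have hδ'δ : δ' ≤ δ := min_le_left _ _
  set N' : ℕ := max (max N 1) ⌈Real.exp (C * δ' ^ (-B))⌉₊ with hN'
  have hN'exp : Real.exp (C * δ' ^ (-B)) ≤ (N' : ℝ) :=
    (Nat.le_ceil _).trans (by exact_mod_cast le_max_right _ _)
  obtain ⟨R, hN'R, -, hR⟩ := h δ' hδ'0 hδ'1 N' hN'exp
  refine ⟨R, ((le_max_left _ _).trans (le_max_left _ _)).trans hN'R, ?_⟩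
  intro a b c habc hrad
  have hR1 : (1 : ℝ) ≤ R := by
    exact_mod_cast ((le_max_right _ _).trans (le_max_left _ _)).trans hN'R
  calc (c : ℝ) ≤ (R : ℝ) ^ (1 + δ') := hR a b c habc hrad
    _ ≤ (R : ℝ) ^ (1 + δ) := Real.rpow_le_rpow_of_exponent_le hR1 (by linarith)

/-- **The pointwise sub-power slack is EXACTLY scale sub-multiplicativity + effective SPARSE good
scales**: `SPS ↔ ScaleSubmultiplicativity ∧ EffectiveSparseGoodScales` (stated fully qualified on one
line; calibration sub-goal of line `SketchIdeator2`).  (→): `submultOfRST_proof` and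
`Target.effectiveGoodScales_of_polyConstant` (all large scales are good, a fortiori every window);
(←): the effective Assembly `Target.polyConstant_of_scaleSubmultiplicativity_of_effectiveSparseGoodScales`
and Legendre duality.  Read against `Target ↔ ScaleSubmultiplicativity ∧ SparseGoodScales`
(definitional) and `Target ↔ ScaleSubmultiplicativity ∧ ABC`: the crux is the sub-power slack with
the location of the sparse good scales made ineffective. [folklore] -/
theorem calib_subPowerSlack_iff_scaleSubmultiplicativity_and_effectiveSparseGoodScales : (∃ τ : ℝ, τ < 1 ∧ ∃ A : ℝ, ∀ a b c : ℕ, Literature.NumberTheory.DiophantineGeometry.IsABCTriple a b c → (c : ℝ) < ((Literature.NumberTheory.DiophantineGeometry.rad a b c : ℕ) : ℝ) * Real.exp (A * Real.log ((Literature.NumberTheory.DiophantineGeometry.rad a b c : ℕ) : ℝ) ^ τ)) ↔ (Summit.ABC.ABC.Theses.FeketeScales.ScaleSubmultiplicativity ∧ ∃ B C : ℝ, ∀ δ : ℝ, 0 < δ → δ ≤ 1 → ∀ N : ℕ, Real.exp (C * δ ^ (-B)) ≤ (N : ℝ) → ∃ R : ℕ, N ≤ R ∧ R ≤ N ^ 2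 ∧ ∀ a b c : ℕ, Literature.NumberTheory.DiophantineGeometry.IsABCTriple a b c → Literature.NumberTheory.DiophantineGeometry.rad a b c ≤ R → (c : ℝ) ≤ (R : ℝ) ^ (1 + δ)) :=
  ⟨fun h => ⟨submultOfRST_proof h, Target.effectiveSparseGoodScales_of_effectiveGoodScales
      (Target.effectiveGoodScales_of_polyConstant (Target.polyConstant_of_subPowerSlack h))⟩,
    fun h => Target.subPowerSlack_of_polyConstant
      (Target.polyConstant_of_scaleSubmultiplicativity_of_effectiveSparseGoodScales h.1 h.2)⟩

/-- Scale sub-multiplicativity + effective sparse good scales give the crux `Target` (via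
`Target.sparseGoodScales_of_effectiveSparseGoodScales`) — the effective thesis refines the crux.
[folklore] -/
theorem Target.target_of_scaleSubmultiplicativity_of_effectiveSparseGoodScales
    (hS : ScaleSubmultiplicativity)
    (hE : ∃ B C : ℝ, ∀ δ : ℝ, 0 < δ → δ ≤ 1 → ∀ N : ℕ, Real.exp (C * δ ^ (-B)) ≤ (N : ℝ) →
      ∃ R : ℕ, N ≤ R ∧ R ≤ N ^ 2 ∧
        ∀ a b c : ℕ, IsABCTriple a b c → rad a b c ≤ R → (c : ℝ) ≤ (R : ℝ) ^ (1 + δ)) :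
    Target :=
  ⟨hS, Target.sparseGoodScales_of_effectiveSparseGoodScales hE⟩

/-- **The line's stub follows from the crux plus effectivity.**  `Target` together with effective
sparse good scales implies the registered stub `stub_ultraCompositeTail` of line `SketchIdeator2`
(indeed the whole sub-power slack): `Target.1 = ScaleSubmultiplicativity`, then
`calib_subPowerSlack_iff_scaleSubmultiplicativity_and_effectiveSparseGoodScales` and
`calib_ultraCompositeTail_of_subPowerSlack`.  So modulo the effectivity of conjunct 2 the ω-split
line is circular: its two stubs are jointly equivalent to the effective crux. [folklore] -/
theorem Target.ultraCompositeTail_of_target_of_effectiveSparseGoodScales (hT : Target)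
    (hE : ∃ B C : ℝ, ∀ δ : ℝ, 0 < δ → δ ≤ 1 → ∀ N : ℕ, Real.exp (C * δ ^ (-B)) ≤ (N : ℝ) →
      ∃ R : ℕ, N ≤ R ∧ R ≤ N ^ 2 ∧
        ∀ a b c : ℕ, IsABCTriple a b c → rad a b c ≤ R → (c : ℝ) ≤ (R : ℝ) ^ (1 + δ)) :
    ∃ θ' θ : ℝ, 0 < θ' ∧ θ' < θ ∧ θ < 1 ∧ ∃ A : ℝ, ∀ a b c : ℕ, IsABCTriple a b c →
      Real.log ((rad a b c : ℕ) : ℝ) ^ θ' < ((ArithmeticFunction.cardDistinctFactors (a * b * c) : ℕ) : ℝ) →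
      (c : ℝ) < ((rad a b c : ℕ) : ℝ) * Real.exp (A * Real.log ((rad a b c : ℕ) : ℝ) ^ θ) :=
  calib_ultraCompositeTail_of_subPowerSlack
    (calib_subPowerSlack_iff_scaleSubmultiplicativity_and_effectiveSparseGoodScales.mpr ⟨hT.1, hE⟩)

/-- **SPS ↔ Target ∧ EffectiveSparseGoodScales.**  The pointwise sub-power slack is exactly the crux
plus the effectivity of its second conjunct: (→) `Target.target_of_subPowerSlack` and the effectivity
from Legendre duality; (←) `calib_subPowerSlack_iff_scaleSubmultiplicativity_and_effectiveSparseGoodScales`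
with `Target.1`. [folklore] -/
theorem Target.subPowerSlack_iff_target_and_effectiveSparseGoodScales :
    (∃ τ : ℝ, τ < 1 ∧ ∃ A : ℝ, ∀ a b c : ℕ, IsABCTriple a b c →
      (c : ℝ) < ((rad a b c : ℕ) : ℝ) * Real.exp (A * Real.log ((rad a b c : ℕ) : ℝ) ^ τ)) ↔
    (Target ∧ ∃ B C : ℝ, ∀ δ : ℝ, 0 < δ → δ ≤ 1 → ∀ N : ℕ, Real.exp (C * δ ^ (-B)) ≤ (N : ℝ) →
      ∃ R : ℕ, N ≤ R ∧ R ≤ N ^ 2 ∧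
        ∀ a b c : ℕ, IsABCTriple a b c → rad a b c ≤ R → (c : ℝ) ≤ (R : ℝ) ^ (1 + δ)) :=
  ⟨fun h => ⟨Target.target_of_subPowerSlack h,
      (calib_subPowerSlack_iff_scaleSubmultiplicativity_and_effectiveSparseGoodScales.mp h).2⟩,
    fun h => calib_subPowerSlack_iff_scaleSubmultiplicativity_and_effectiveSparseGoodScales.mpr
      ⟨h.1.1, h.2⟩⟩

/-- **Under the crux, effectivity of the sparse good scales IS the sub-power slack**: assuming
`Target`, `EffectiveSparseGoodScales ↔ SPS`.  What a proof of the crux would still owe towards the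
Robert–Stewart–Tenenbaum-type bound is precisely an effective location of the good scales. [folklore] -/
theorem Target.effectiveSparseGoodScales_iff_subPowerSlack_of_target (hT : Target) :
    (∃ B C : ℝ, ∀ δ : ℝ, 0 < δ → δ ≤ 1 → ∀ N : ℕ, Real.exp (C * δ ^ (-B)) ≤ (N : ℝ) →
      ∃ R : ℕ, N ≤ R ∧ R ≤ N ^ 2 ∧
        ∀ a b c : ℕ, IsABCTriple a b c → rad a b c ≤ R → (c : ℝ) ≤ (R : ℝ) ^ (1 + δ)) ↔
    (∃ τ : ℝ, τ < 1 ∧ ∃ A : ℝ, ∀ a b c : ℕ, IsABCTriple a b c →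
      (c : ℝ) < ((rad a b c : ℕ) : ℝ) * Real.exp (A * Real.log ((rad a b c : ℕ) : ℝ) ^ τ)) :=
  ⟨fun hE => Target.subPowerSlack_iff_target_and_effectiveSparseGoodScales.mpr ⟨hT, hE⟩,
    fun h => (Target.subPowerSlack_iff_target_and_effectiveSparseGoodScales.mp h).2⟩

end Summit.ABC.ABC.Theorems
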